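import Literature.NumberTheory.GelbartRogawski1991.UnitaryDualPairSeesawCharacterLeft
import Literature.NumberTheory.GelbartRogawski1991.UnitaryDualPairWeilCoinvariants
import Literature.NumberTheory.Weil1964.AdelicMetaplecticFinRepBlockDiag
import Literature.NumberTheory.Automorphic.UnitaryGroupDirectSumCarriersFinite
import HarnessLib

/-!
# The finite Weil representation of `U(V₁ ⊕ V₂) × U(W)` restricted to `U(V₁) × U(V₂)`: the tensor decomposition of the
# finite factors and of the central coinvariants («face slices»)

Setting (★ `UnitaryDualPairSeesawCharacterLeft`, V-side Kronecker coordinates `Fin (N₁ + N₂) × Fin M`): a quadratic extension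
`E/F` of number fields, hermitian Gram data `J₁, J₂, J_W` over symmetric `T₁, T₂, T_W`, the orthogonal sum `J_V = J₁ ⊕ᶠ J₂`, and
THREE compatible splittings `s, s₁, s₂` ([GelbartRogawski1991, Prop. 3.1.1]) of the dual pairs `(U(J_V), U(J_W))`, `(U(J₁), U(J_W))`,
`(U(J₂), U(J_W))`, with their V-side see-saw character `χ_L = mpSeesawCharLeft` ([Kudla1984, §1]; [Liu2021], proof of Thm. 4.15
l. 2199–2210: «the restriction of `ω_{μ,ε}` to `U(V⋆) × U(V⋆^⊥)` …»).

* §1 `finSumTensorLeft : 𝒮₁ ⊗ 𝒮₂ ≃ₗ 𝒮_V` (`f₁ ⊗ f₂ ↦ R_{e_Σ}⁻¹ (f₁ ⊠ f₂)`, ★ `finSumEquiv` + ★ `finSBReindex`) and the FINITE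
  SEE-SAW IDENTITY `finPairRep_finAdelicBlockDiag_finSumTensorLeft`:
  `ω_f^V(s)((k₁ ⊕ᶠ k₂), u) (L(f₁ ⊗ f₂)) = χ_L(((k₁,k₂),u)) • L(ω_f^{V₁}(s₁)(k₁,u) f₁ ⊗ ω_f^{V₂}(s₂)(k₂,u) f₂)` — the finite-adelic
  form of ★ `mpSeesawCharLeft_spec` (pure-tensor descent through ★ `omega_pairSmall₁_finPairToAdelic_tmul` and the finite slice at
  the origin, as in ★ `finRepMp_finSumEquiv_tmul`); with the bookkeeping `finAdelicToAdelic_finAdelicBlockDiag`.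
* §2 under the hypothesis `hχV` that `χ_L` is trivial on `U(J₁)(𝔸) × 1 × 1` (at the χ-attached splittings of [Liu2021, App. D
  §D.1 Step 2] this is the content of the see-saw step of the proof of [Liu2021, Thm. 4.15]): the W-side character
  `seesawCharW u := χ_L((1,1),u)` and the identity at `k₂ = 1`; §3 the two transport identities on all of `𝒮₁ ⊗ 𝒮₂`.
* §4 GENERIC (`TwistedCoinv` algebra over a commutative ring `k`): for a tensor decomposition `T : S₁ ⊗ S₂ ≃ S` carrying
  `ρ₁ ⊗ ρ₂` to `ξ⁻¹ • ρ_W`, `splitCoinvEquiv : Coinv ρ_W χ ≃ₗ Coinv (ρ₁ ⊗ ρ₂) (χ · ξ⁻¹)` (★ `TwistedCoinv.mapEquiv`), the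
  first-factor action `splitRep` (`σ₁ ⊗ 1`) and the equivariance `splitCoinvEquiv_rep`.  (Stated generically on purpose: the tensor
  product is formed once from `[AddCommGroup Sᵢ]`; §5 instantiates.)
* §5 the FACE IDENTIFICATION `faceSplitCoinvEquiv : Coinv (ω_f^V(s)|_{U(W)}) χ_W ≃ₗ Coinv (ω_f^{V₁}(s₁)|_{U(W)} ⊗ ω_f^{V₂}(s₂)|_{U(W)})
  (χ_W · ξ⁻¹)` and its `U(J₁)(𝔸_f)`-equivariance `faceSplitCoinvEquiv_weilCoinv` (`weilCoinv^V(k₁ ⊕ᶠ 1) ↦ ω_f^{V₁}(s₁)(k₁) ⊗ 1`);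
  for `M = 1`, `J_W = ⟨a⟩` the source is [Liu2021, Def. 4.11]'s `ω(μ,ε,χ)` at the line (`omegaAtLine`, `rfl`) and the first factor's
  action is `rhoVAtLine` at `J₁`.

Definitions with bodies + theorems only; no named fact, no instance, no `sorry`.

## References
* [Kudla1984] S. Kudla, *Seesaw dual reductive pairs*, Progr. Math. 46 (1984), §1.
* [MoeglinVignerasWaldspurger1987] C. Mœglin, M.-F. Vignéras, J.-L. Waldspurger, LNM 1291 (1987), Chap. 2 II.1.
* [Weil1964] A. Weil, Acta Math. 111 (1964), Chap. III n° 37–38 pp. 187–189.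
* [GelbartRogawski1991] S. Gelbart, J. Rogawski, Invent. Math. 105 (1991), §3.1 Prop. 3.1.1 p. 455, Remark p. 457.
* [Liu2021] Y. Liu, Camb. J. Math. 9 (2021) = arXiv:2102.11518: proof of Thm. 4.15 (l. 2199–2210), Def. 4.11, App. D §D.1 Step 3.
-/

set_option autoImplicit false

noncomputable section

open scoped Matrix Kronecker TensorProduct SchwartzMap Classical
open NumberField NumberField.mixedEmbedding IsDedekindDomain
open Literature.NumberTheory.Automorphic Literature.NumberTheory.Automorphic.UnitaryGroup
open Literature.NumberTheory.Weil1964 Literature.RepresentationTheory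
open Literature.NumberTheory.GelbartRogawski1991.UnitaryDualPair.WeilCoinv

namespace Literature.NumberTheory.GelbartRogawski1991.UnitaryDualPair

/-! ## §0 Index bookkeeping -/

/-- the V-side sum relabelling `e_Σ : Fin (N₁ + N₂) × Fin M ≃ (Fin N₁ × Fin M) ⊕ (Fin N₂ × Fin M)` of ★
`UnitaryDualPairSeesawCharacterLeft` (reducible, so that it unifies with the inline term there). [cite: Kudla1984, §1] -/
abbrev sigmaEquiv (N₁ N₂ M : ℕ) : Fin (N₁ + N₂) × Fin M ≃ (Fin N₁ × Fin M) ⊕ (Fin N₂ × Fin M) :=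
  (finSumFinEquiv.prodCongr (Equiv.refl (Fin M))).symm.trans (Equiv.sumProdDistrib (Fin N₁) (Fin N₂) (Fin M))

section FaceSplit

variable (F E : Type) [Field F] [NumberField F] [Field E] [NumberField E] [Algebra F E]
variable (c : E ≃ₐ[F] E) (N₁ N₂ M : ℕ) {n n₁ n₂ : ℕ}
  (eV : Fin (N₁ + N₂) × Fin M ≃ Fin n) (e₁ : Fin N₁ × Fin M ≃ Fin n₁) (e₂ : Fin N₂ × Fin M ≃ Fin n₂)
variable (J₁ : Matrix (Fin N₁) (Fin N₁) E) (J₂ : Matrix (Fin N₂) (Fin N₂) E) (JW : Matrix (Fin M) (Fin M) E)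
variable {T₁ : Matrix (Fin N₁) (Fin N₁) F} {T₂ : Matrix (Fin N₂) (Fin N₂) F} {TW : Matrix (Fin M) (Fin M) F}

/-! ## §1 The finite split tensor and the finite see-saw identity -/

/-- **the finite split tensor** `f₁ ⊗ f₂ ↦ R_{e_Σ}⁻¹ (f₁ ⊠ f₂)`: `𝒮((𝔸_f)^{N₁ M}) ⊗ 𝒮((𝔸_f)^{N₂ M}) ≃ₗ 𝒮((𝔸_f)^{(N₁+N₂) M})`
— the finite-adelic twin of ★ `sumTensor F e_Σ`. [cite: Kudla1984, §1] [cite: MoeglinVignerasWaldspurger1987, Chap. 2 II.1] -/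
def finSumTensorLeft :
    FinSB F (Fin N₁ × Fin M) ⊗[ℂ] FinSB F (Fin N₂ × Fin M) ≃ₗ[ℂ] FinSB F (Fin (N₁ + N₂) × Fin M) :=
  (finSumEquiv F (Fin N₁ × Fin M) (Fin N₂ × Fin M)).trans (finSBReindex F (sigmaEquiv N₁ N₂ M)).symm

/-- **the finite-adelic see-saw points** `((k₁, k₂), u) ↦ ((ι k₁, ι k₂), ι u)` inside the adelic see-saw group
`(U(J₁)(𝔸) × U(J₂)(𝔸)) × U(J_W)(𝔸)`. [cite: Kudla1984, §1] -/
def finSeesawToAdelic :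
    (finAdelic F E c N₁ J₁ × finAdelic F E c N₂ J₂) × finAdelic F E c M JW →*
      (adelic F E c N₁ J₁ × adelic F E c N₂ J₂) × adelic F E c M JW :=
  ((finAdelicToAdelic F E c N₁ J₁).prodMap (finAdelicToAdelic F E c N₂ J₂)).prodMap (finAdelicToAdelic F E c M JW)

/-- `ι(k₁ ⊕ᶠ k₂) = ι(k₁) ⊕ᶠ ι(k₂)`: the finite-adelic block-diagonal embedding is the adelic one on finite-adelic points.
[cite: Kudla1984, §1] -/
theorem finAdelicToAdelic_finAdelicBlockDiag (k : finAdelic F E c N₁ J₁ × finAdelic F E c N₂ J₂) :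
    finAdelicToAdelic F E c (N₁ + N₂) (finSum N₁ N₂ J₁ J₂) (finAdelicBlockDiag F E c N₁ N₂ J₁ J₂ k) =
      adelicBlockDiag F E c N₁ N₂ J₁ J₂ (finAdelicToAdelic F E c N₁ J₁ k.1, finAdelicToAdelic F E c N₂ J₂ k.2) := by
  refine Subtype.ext (Units.ext (Matrix.ext fun i j => ?_))
  change ((GLn.ofFinite (N₁ + N₂) E
      (finAdelicBlockDiag F E c N₁ N₂ J₁ J₂ k : GL (Fin (N₁ + N₂)) (FiniteAdeleRing (𝓞 E) E)) :
        GL (Fin (N₁ + N₂)) (AdeleRing (𝓞 E) E)) : Matrix (Fin (N₁ + N₂)) (Fin (N₁ + N₂)) (AdeleRing (𝓞 E) E)) i j =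
    ((adelicBlockDiag F E c N₁ N₂ J₁ J₂ (finAdelicToAdelic F E c N₁ J₁ k.1, finAdelicToAdelic F E c N₂ J₂ k.2) :
        GL (Fin (N₁ + N₂)) (AdeleRing (𝓞 E) E)) : Matrix (Fin (N₁ + N₂)) (Fin (N₁ + N₂)) (AdeleRing (𝓞 E) E)) i j
  rw [GLn.coe_ofFinite_apply, coe_finAdelicBlockDiag, coe_adelicBlockDiag, UnitaryGroup.coe_reindexGL, UnitaryGroup.coe_reindexGL,
    Matrix.reindex_apply, Matrix.reindex_apply, Matrix.submatrix_apply, Matrix.submatrix_apply, UnitaryGroup.coe_blockDiagGL,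
    UnitaryGroup.coe_blockDiagGL]
  -- the two factors `U(J_j)(𝔸_f) → U(J_j)(𝔸)` on matrices are `GLn.ofFinite` (definitional)
  have h1 : (Subtype.val (finAdelicToAdelic F E c N₁ J₁ k.1) : GL (Fin N₁) (AdeleRing (𝓞 E) E)) =
      GLn.ofFinite N₁ E (k.1 : GL (Fin N₁) (FiniteAdeleRing (𝓞 E) E)) := rfl
  have h2 : (Subtype.val (finAdelicToAdelic F E c N₂ J₂ k.2) : GL (Fin N₂) (AdeleRing (𝓞 E) E)) =
      GLn.ofFinite N₂ E (k.2 : GL (Fin N₂) (FiniteAdeleRing (𝓞 E) E)) := rfl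
  erw [h1, h2]
  rcases hi : finSumFinEquiv.symm i with a | a <;> rcases hj : finSumFinEquiv.symm j with b | b
  · rw [Matrix.fromBlocks_apply₁₁, Matrix.fromBlocks_apply₁₁, GLn.coe_ofFinite_apply]
    refine Prod.ext ?_ rfl
    have : (i = j) ↔ (a = b) := by
      rw [← finSumFinEquiv.symm.injective.eq_iff, hi, hj, Sum.inl.injEq]
    change (1 : Matrix _ _ (InfiniteAdeleRing E)) i j = (1 : Matrix _ _ (InfiniteAdeleRing E)) a b
    simp only [Matrix.one_apply, this]
  · rw [Matrix.fromBlocks_apply₁₂, Matrix.fromBlocks_apply₁₂, Matrix.zero_apply, Matrix.zero_apply]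
    have hne : i ≠ j := fun h => by subst h; rw [hi] at hj; exact Sum.inl_ne_inr hj
    refine Prod.ext ?_ rfl
    change (1 : Matrix _ _ (InfiniteAdeleRing E)) i j = 0
    rw [Matrix.one_apply_ne hne]
  · rw [Matrix.fromBlocks_apply₂₁, Matrix.fromBlocks_apply₂₁, Matrix.zero_apply, Matrix.zero_apply]
    have hne : i ≠ j := fun h => by subst h; rw [hi] at hj; exact Sum.inr_ne_inl hj
    refine Prod.ext ?_ rfl
    change (1 : Matrix _ _ (InfiniteAdeleRing E)) i j = 0
    rw [Matrix.one_apply_ne hne]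
  · rw [Matrix.fromBlocks_apply₂₂, Matrix.fromBlocks_apply₂₂, GLn.coe_ofFinite_apply]
    refine Prod.ext ?_ rfl
    have : (i = j) ↔ (a = b) := by
      rw [← finSumFinEquiv.symm.injective.eq_iff, hi, hj, Sum.inr.injEq]
    change (1 : Matrix _ _ (InfiniteAdeleRing E)) i j = (1 : Matrix _ _ (InfiniteAdeleRing E)) a b
    simp only [Matrix.one_apply, this]

variable [Algebra.IsQuadraticExtension F E] {δ : E} (hcδ : c δ = -δ) (hδ : δ ≠ 0) {d : F}
  (hd : δ * δ = algebraMap F E d) (h₁ : T₁.IsSymm) (h₂ : T₂.IsSymm) (hW : TW.IsSymm) (h₁d : IsUnit T₁.det)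
  (h₂d : IsUnit T₂.det) (hWd : IsUnit TW.det) (hVd : IsUnit (finSum N₁ N₂ T₁ T₂).det)
  (hJ₁ : J₁ = T₁.map (algebraMap F E)) (hJ₂ : J₂ = T₂.map (algebraMap F E)) (hJW : JW = TW.map (algebraMap F E))

variable {s : adelicPair F E c (N₁ + N₂) M (finSum N₁ N₂ J₁ J₂) JW →*
    adelicMpCont F (Fin n) (adelicGram F eV (finSum N₁ N₂ T₁ T₂) TW)}
  {s₁ : adelicPair F E c N₁ M J₁ JW →* adelicMpCont F (Fin n₁) (adelicGram F e₁ T₁ TW)}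
  {s₂ : adelicPair F E c N₂ M J₂ JW →* adelicMpCont F (Fin n₂) (adelicGram F e₂ T₂ TW)}
  (hs : (splittingDatum F E c (N₁ + N₂) M eV (finSum N₁ N₂ J₁ J₂) JW hcδ hδ hd (isSymm_finSum h₁ h₂) hW hVd hWd
    (finSum_eq_map_finSum F E N₁ N₂ J₁ J₂ hJ₁ hJ₂) hJW).IsCompatible s)
  (hs₁ : (splittingDatum F E c N₁ M e₁ J₁ JW hcδ hδ hd h₁ hW h₁d hWd hJ₁ hJW).IsCompatible s₁)
  (hs₂ : (splittingDatum F E c N₂ M e₂ J₂ JW hcδ hδ hd h₂ hW h₂d hWd hJ₂ hJW).IsCompatible s₂)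

/-- **THE FINITE SEE-SAW IDENTITY** (finite-adelic form of ★ `mpSeesawCharLeft_spec`): for finite-adelic `k₁, k₂, u` and
finite test functions `f₁, f₂`,
`ω_f^V(s)((k₁ ⊕ᶠ k₂), u) (f₁ ⊠ f₂) = χ_L(((k₁,k₂),u)) • (ω_f^{V₁}(s₁)(k₁,u) f₁ ⊠ ω_f^{V₂}(s₂)(k₂,u) f₂)`.
[cite: Kudla1984, §1] [cite: MoeglinVignerasWaldspurger1987, Chap. 2 II.1] [cite: Weil1964, Chap. III n° 37–38 pp. 187–189] -/
theorem finPairRep_finAdelicBlockDiag_finSumTensorLeft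
    (k₁ : finAdelic F E c N₁ J₁) (k₂ : finAdelic F E c N₂ J₂) (u : finAdelic F E c M JW)
    (f₁ : FinSB F (Fin N₁ × Fin M)) (f₂ : FinSB F (Fin N₂ × Fin M)) :
    finPairRep F E c (N₁ + N₂) M eV (finSum N₁ N₂ J₁ J₂) JW hcδ hδ hd (isSymm_finSum h₁ h₂) hW hVd hWd
        (finSum_eq_map_finSum F E N₁ N₂ J₁ J₂ hJ₁ hJ₂) hJW hs (finAdelicBlockDiag F E c N₁ N₂ J₁ J₂ (k₁, k₂), u)
        (finSumTensorLeft F N₁ N₂ M (f₁ ⊗ₜ f₂)) =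
      ((mpSeesawCharLeft F E c N₁ N₂ M eV e₁ e₂ J₁ J₂ JW hcδ hδ hd h₁ h₂ hW h₁d h₂d hWd hVd hJ₁ hJ₂ hJW hs hs₁ hs₂
          (finSeesawToAdelic F E c N₁ N₂ M J₁ J₂ JW ((k₁, k₂), u)) : ℂˣ) : ℂ) •
        finSumTensorLeft F N₁ N₂ M
          (finPairRep F E c N₁ M e₁ J₁ JW hcδ hδ hd h₁ hW h₁d hWd hJ₁ hJW hs₁ (k₁, u) f₁ ⊗ₜ
            finPairRep F E c N₂ M e₂ J₂ JW hcδ hδ hd h₂ hW h₂d hWd hJ₂ hJW hs₂ (k₂, u) f₂) := by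
  -- archimedean test functions with `φ_j(0) = 1`
  obtain ⟨φ₁, hφ₁⟩ := exists_schwartzMap_apply_zero_eq_one (F := F) (Fin N₁ × Fin M)
  obtain ⟨φ₂, hφ₂⟩ := exists_schwartzMap_apply_zero_eq_one (F := F) (Fin N₂ × Fin M)
  -- the archimedean factor of `R_{e_Σ}⁻¹ (φ₁ ⊠_∞ φ₂)` is `1` at the origin
  have hA : schwartzReindexCLM F (sigmaEquiv N₁ N₂ M).symm (archBoxTensor φ₁ φ₂) 0 = 1 := by
    rw [schwartzReindexCLM_apply, archBoxTensor_apply]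
    change φ₁ 0 * φ₂ 0 = 1
    rw [hφ₁, hφ₂, one_mul]
  -- `sumTensor` on pure tensors is a pure tensor with finite part `finSumTensorLeft`
  have hsum : ∀ (ψ₁ : 𝓢(((Fin N₁ × Fin M) → mixedSpace F), ℂ)) (g₁ : FinSB F (Fin N₁ × Fin M))
      (ψ₂ : 𝓢(((Fin N₂ × Fin M) → mixedSpace F), ℂ)) (g₂ : FinSB F (Fin N₂ × Fin M)),
      sumTensor F (sigmaEquiv N₁ N₂ M) (piSchwartzBruhatEquiv F _ (ψ₁ ⊗ₜ g₁)) (piSchwartzBruhatEquiv F _ (ψ₂ ⊗ₜ g₂)) =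
        piSchwartzBruhatEquiv F _
          (schwartzReindexCLM F (sigmaEquiv N₁ N₂ M).symm (archBoxTensor ψ₁ ψ₂) ⊗ₜ finSumTensorLeft F N₁ N₂ M (g₁ ⊗ₜ g₂)) :=
    fun ψ₁ g₁ ψ₂ g₂ => by
      rw [sumTensor_def, tensorToSum_tmul, piSBReindex_symm, piSBReindex_tmul]
      rfl
  -- the three operators in the identity, read on finite-adelic points (`seesaw* = pairSmall₁ ∘ finPairToAdelic`)
  have hq : (adelicBlockDiag F E c N₁ N₂ J₁ J₂ (finSeesawToAdelic F E c N₁ N₂ M J₁ J₂ JW ((k₁, k₂), u)).1,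
        (finSeesawToAdelic F E c N₁ N₂ M J₁ J₂ JW ((k₁, k₂), u)).2) =
      finPairToAdelic F E c (N₁ + N₂) M (finSum N₁ N₂ J₁ J₂) JW (finAdelicBlockDiag F E c N₁ N₂ J₁ J₂ (k₁, k₂), u) :=
    Prod.ext (finAdelicToAdelic_finAdelicBlockDiag F E c N₁ N₂ J₁ J₂ (k₁, k₂)).symm rfl
  have hbig : seesawBigLeft F E c N₁ N₂ M eV J₁ J₂ JW s (finSeesawToAdelic F E c N₁ N₂ M J₁ J₂ JW ((k₁, k₂), u)) =
      pairSmall₁ F E c (N₁ + N₂) M eV (finSum N₁ N₂ J₁ J₂) JW s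
        (finPairToAdelic F E c (N₁ + N₂) M (finSum N₁ N₂ J₁ J₂) JW (finAdelicBlockDiag F E c N₁ N₂ J₁ J₂ (k₁, k₂), u)) :=
    (seesawBigLeft_apply F E c N₁ N₂ M eV J₁ J₂ JW s _).trans
      (congrArg (fun q => (adelicMpContReindex F eV ((finSum N₁ N₂ T₁ T₂).map (algebraMap F (AdeleRing (𝓞 F) F)) ⊗ₖ
          TW.map (algebraMap F (AdeleRing (𝓞 F) F)))).symm
        (pairSplitting F E c (N₁ + N₂) M eV (finSum N₁ N₂ J₁ J₂) JW s q)) hq)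
  have hsm₁ : seesawSmallLeft₁ F E c N₁ N₂ M e₁ J₁ J₂ JW s₁ (finSeesawToAdelic F E c N₁ N₂ M J₁ J₂ JW ((k₁, k₂), u)) =
      pairSmall₁ F E c N₁ M e₁ J₁ JW s₁ (finPairToAdelic F E c N₁ M J₁ JW (k₁, u)) :=
    seesawSmallLeft₁_apply F E c N₁ N₂ M e₁ J₁ J₂ JW s₁ _
  have hsm₂ : seesawSmallLeft₂ F E c N₁ N₂ M e₂ J₁ J₂ JW s₂ (finSeesawToAdelic F E c N₁ N₂ M J₁ J₂ JW ((k₁, k₂), u)) =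
      pairSmall₁ F E c N₂ M e₂ J₂ JW s₂ (finPairToAdelic F E c N₂ M J₂ JW (k₂, u)) :=
    seesawSmallLeft₂_apply F E c N₁ N₂ M e₂ J₁ J₂ JW s₂ _
  -- ★ the adelic see-saw identity at the pure tensors `φ_j ⊗ f_j`
  have key := mpSeesawCharLeft_spec F E c N₁ N₂ M eV e₁ e₂ J₁ J₂ JW hcδ hδ hd h₁ h₂ hW h₁d h₂d hWd hVd hJ₁ hJ₂ hJW hs hs₁ hs₂
    (finSeesawToAdelic F E c N₁ N₂ M J₁ J₂ JW ((k₁, k₂), u))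
    (piSchwartzBruhatEquiv F _ (φ₁ ⊗ₜ f₁)) (piSchwartzBruhatEquiv F _ (φ₂ ⊗ₜ f₂))
  -- both sides are `R_{e_Σ}⁻¹(φ₁ ⊠_∞ φ₂) ⊗ (finite part)` (`congrArg` chains only, no `rw` on the adelic operators)
  have ebig := ((congrArg (fun q => adelicMpCont.omega F (Fin (N₁ + N₂) × Fin M)
        ((finSum N₁ N₂ T₁ T₂).map (algebraMap F (AdeleRing (𝓞 F) F)) ⊗ₖ TW.map (algebraMap F (AdeleRing (𝓞 F) F))) q
        (sumTensor F (sigmaEquiv N₁ N₂ M) (piSchwartzBruhatEquiv F _ (φ₁ ⊗ₜ f₁)) (piSchwartzBruhatEquiv F _ (φ₂ ⊗ₜ f₂))))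
      hbig).trans
    (congrArg _ (hsum φ₁ f₁ φ₂ f₂))).trans
    (omega_pairSmall₁_finPairToAdelic_tmul F E c (N₁ + N₂) M eV (finSum N₁ N₂ J₁ J₂) JW hcδ hδ hd (isSymm_finSum h₁ h₂)
      hW hVd hWd (finSum_eq_map_finSum F E N₁ N₂ J₁ J₂ hJ₁ hJ₂) hJW hs (finAdelicBlockDiag F E c N₁ N₂ J₁ J₂ (k₁, k₂), u)
      (schwartzReindexCLM F (sigmaEquiv N₁ N₂ M).symm (archBoxTensor φ₁ φ₂)) (finSumTensorLeft F N₁ N₂ M (f₁ ⊗ₜ f₂)))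
  have esm₁ := (congrArg (fun q => adelicMpCont.omega F (Fin N₁ × Fin M)
        (T₁.map (algebraMap F (AdeleRing (𝓞 F) F)) ⊗ₖ TW.map (algebraMap F (AdeleRing (𝓞 F) F))) q
        (piSchwartzBruhatEquiv F _ (φ₁ ⊗ₜ f₁))) hsm₁).trans
    (omega_pairSmall₁_finPairToAdelic_tmul F E c N₁ M e₁ J₁ JW hcδ hδ hd h₁ hW h₁d hWd hJ₁ hJW hs₁ (k₁, u) φ₁ f₁)
  have esm₂ := (congrArg (fun q => adelicMpCont.omega F (Fin N₂ × Fin M)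
        (T₂.map (algebraMap F (AdeleRing (𝓞 F) F)) ⊗ₖ TW.map (algebraMap F (AdeleRing (𝓞 F) F))) q
        (piSchwartzBruhatEquiv F _ (φ₂ ⊗ₜ f₂))) hsm₂).trans
    (omega_pairSmall₁_finPairToAdelic_tmul F E c N₂ M e₂ J₂ JW hcδ hδ hd h₂ hW h₂d hWd hJ₂ hJW hs₂ (k₂, u) φ₂ f₂)
  have erhs := (congrArg₂ (fun x y => sumTensor F (sigmaEquiv N₁ N₂ M) x y) esm₁ esm₂).trans
    (hsum φ₁ _ φ₂ _)
  have cmp := (ebig.symm.trans key).trans (congrArg (fun z => ((mpSeesawCharLeft F E c N₁ N₂ M eV e₁ e₂ J₁ J₂ JW hcδ hδ hd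
      h₁ h₂ hW h₁d h₂d hWd hVd hJ₁ hJ₂ hJW hs hs₁ hs₂ (finSeesawToAdelic F E c N₁ N₂ M J₁ J₂ JW ((k₁, k₂), u)) : ℂˣ) : ℂ) • z)
      erhs)
  -- strip the common archimedean factor with the finite slice at the origin
  have s1 := finSliceLM_tmul (0 : (Fin (N₁ + N₂) × Fin M) → mixedSpace F)
    (schwartzReindexCLM F (sigmaEquiv N₁ N₂ M).symm (archBoxTensor φ₁ φ₂))
    (finPairRep F E c (N₁ + N₂) M eV (finSum N₁ N₂ J₁ J₂) JW hcδ hδ hd (isSymm_finSum h₁ h₂) hW hVd hWd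
      (finSum_eq_map_finSum F E N₁ N₂ J₁ J₂ hJ₁ hJ₂) hJW hs (finAdelicBlockDiag F E c N₁ N₂ J₁ J₂ (k₁, k₂), u)
      (finSumTensorLeft F N₁ N₂ M (f₁ ⊗ₜ f₂)))
  have s2 := finSliceLM_tmul (0 : (Fin (N₁ + N₂) × Fin M) → mixedSpace F)
    (schwartzReindexCLM F (sigmaEquiv N₁ N₂ M).symm (archBoxTensor φ₁ φ₂))
    (finSumTensorLeft F N₁ N₂ M
      (finPairRep F E c N₁ M e₁ J₁ JW hcδ hδ hd h₁ hW h₁d hWd hJ₁ hJW hs₁ (k₁, u) f₁ ⊗ₜ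
        finPairRep F E c N₂ M e₂ J₂ JW hcδ hδ hd h₂ hW h₂d hWd hJ₂ hJW hs₂ (k₂, u) f₂))
  rw [hA, one_smul] at s1 s2
  exact s1.symm.trans (((congrArg (finSliceLM F (Fin (N₁ + N₂) × Fin M) 0) cmp).trans (map_smul _ _ _)).trans
    (congrArg _ s2))

/-! ## §2 Trivial V₁-side see-saw character: the W-side character and the identity at `k₂ = 1` -/

/-- **the W-side see-saw character** `ξ(u) := χ_L((1,1), ι u)` on `U(J_W)(𝔸_{F,f})` (automorphic: `= 1` on `U(J_W)(F)` by ★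
`mpSeesawCharLeft_eq_one_of_rational`). [cite: GelbartRogawski1991, §3.1 Remark p. 457] -/
def seesawCharW : finAdelic F E c M JW →* ℂˣ :=
  (mpSeesawCharLeft F E c N₁ N₂ M eV e₁ e₂ J₁ J₂ JW hcδ hδ hd h₁ h₂ hW h₁d h₂d hWd hVd hJ₁ hJ₂ hJW hs hs₁ hs₂).comp
    ((MonoidHom.inr (adelic F E c N₁ J₁ × adelic F E c N₂ J₂) (adelic F E c M JW)).comp (finAdelicToAdelic F E c M JW))

variable (hχV : ∀ g₁ : adelic F E c N₁ J₁,
  mpSeesawCharLeft F E c N₁ N₂ M eV e₁ e₂ J₁ J₂ JW hcδ hδ hd h₁ h₂ hW h₁d h₂d hWd hVd hJ₁ hJ₂ hJW hs hs₁ hs₂ ((g₁, 1), 1) = 1)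

include hχV in
/-- under `hχV`: `χ_L(((k₁, 1), u)) = ξ(u)`. [cite: GelbartRogawski1991, §3.1 Remark p. 457] -/
theorem mpSeesawCharLeft_finSeesawToAdelic_of_trivial (k₁ : finAdelic F E c N₁ J₁) (u : finAdelic F E c M JW) :
    mpSeesawCharLeft F E c N₁ N₂ M eV e₁ e₂ J₁ J₂ JW hcδ hδ hd h₁ h₂ hW h₁d h₂d hWd hVd hJ₁ hJ₂ hJW hs hs₁ hs₂
        (finSeesawToAdelic F E c N₁ N₂ M J₁ J₂ JW ((k₁, 1), u)) =
      seesawCharW F E c N₁ N₂ M eV e₁ e₂ J₁ J₂ JW hcδ hδ hd h₁ h₂ hW h₁d h₂d hWd hVd hJ₁ hJ₂ hJW hs hs₁ hs₂ u := by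
  have hsplit : finSeesawToAdelic F E c N₁ N₂ M J₁ J₂ JW ((k₁, 1), u) =
      (((finAdelicToAdelic F E c N₁ J₁ k₁, 1), 1) :
          (↥(adelic F E c N₁ J₁) × ↥(adelic F E c N₂ J₂)) × ↥(adelic F E c M JW)) *
        (MonoidHom.inr (adelic F E c N₁ J₁ × adelic F E c N₂ J₂) (adelic F E c M JW)) (finAdelicToAdelic F E c M JW u) := by
    refine Prod.ext (Prod.ext ?_ ?_) ?_
    · exact (mul_one _).symm
    · change finAdelicToAdelic F E c N₂ J₂ 1 = 1 * 1
      rw [map_one, mul_one]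
    · exact (one_mul _).symm
  rw [hsplit, map_mul, hχV, one_mul]
  rfl

include hχV in
/-- **the face identity at `k₂ = 1`**: `ω_f^V(s)((k₁ ⊕ᶠ 1), u) (f₁ ⊠ f₂) = ξ(u) • (ω_f^{V₁}(s₁)(k₁,u) f₁ ⊠ ω_f^{V₂}(s₂)(1,u) f₂)`.
[cite: Liu2021, proof of Thm. 4.15 (FJcycle.tex l. 2199–2210)] [cite: Kudla1984, §1] -/
theorem finPairRep_finAdelicBlockDiag_one_finSumTensorLeft
    (k₁ : finAdelic F E c N₁ J₁) (u : finAdelic F E c M JW) (f₁ : FinSB F (Fin N₁ × Fin M)) (f₂ : FinSB F (Fin N₂ × Fin M)) :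
    finPairRep F E c (N₁ + N₂) M eV (finSum N₁ N₂ J₁ J₂) JW hcδ hδ hd (isSymm_finSum h₁ h₂) hW hVd hWd
        (finSum_eq_map_finSum F E N₁ N₂ J₁ J₂ hJ₁ hJ₂) hJW hs (finAdelicBlockDiag F E c N₁ N₂ J₁ J₂ (k₁, 1), u)
        (finSumTensorLeft F N₁ N₂ M (f₁ ⊗ₜ f₂)) =
      ((seesawCharW F E c N₁ N₂ M eV e₁ e₂ J₁ J₂ JW hcδ hδ hd h₁ h₂ hW h₁d h₂d hWd hVd hJ₁ hJ₂ hJW hs hs₁ hs₂ u : ℂˣ) : ℂ) •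
        finSumTensorLeft F N₁ N₂ M
          (finPairRep F E c N₁ M e₁ J₁ JW hcδ hδ hd h₁ hW h₁d hWd hJ₁ hJW hs₁ (k₁, u) f₁ ⊗ₜ
            finPairRepW F E c N₂ M e₂ J₂ JW hcδ hδ hd h₂ hW h₂d hWd hJ₂ hJW hs₂ u f₂) := by
  rw [finPairRep_finAdelicBlockDiag_finSumTensorLeft F E c N₁ N₂ M eV e₁ e₂ J₁ J₂ JW hcδ hδ hd h₁ h₂ hW h₁d h₂d hWd hVd
      hJ₁ hJ₂ hJW hs hs₁ hs₂,
    mpSeesawCharLeft_finSeesawToAdelic_of_trivial F E c N₁ N₂ M eV e₁ e₂ J₁ J₂ JW hcδ hδ hd h₁ h₂ hW h₁d h₂d hWd hVd hJ₁ hJ₂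
      hJW hs hs₁ hs₂ hχV, finPairRepW_apply]

/-! ## §3 The face transport hypotheses at FinSB level (all of `𝒮₁ ⊗ 𝒮₂`, by linearity from §2) -/

include hχV in
/-- **W-side transport hypothesis**: `ω_f^V(s)(1 ⊕ᶠ 1, u) ∘ L = ξ(u) • L ∘ (ω_f^{V₁}(s₁)(1,u) ⊗ ω_f^{V₂}(s₂)(1,u))` on ALL of
`𝒮₁ ⊗ 𝒮₂` (`L = finSumTensorLeft`). [cite: Kudla1984, §1] -/
theorem finPairRepW_finSumTensorLeft (u : finAdelic F E c M JW)
    (x : FinSB F (Fin N₁ × Fin M) ⊗[ℂ] FinSB F (Fin N₂ × Fin M)) :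
    finPairRepW F E c (N₁ + N₂) M eV (finSum N₁ N₂ J₁ J₂) JW hcδ hδ hd (isSymm_finSum h₁ h₂) hW hVd hWd
        (finSum_eq_map_finSum F E N₁ N₂ J₁ J₂ hJ₁ hJ₂) hJW hs u (finSumTensorLeft F N₁ N₂ M x) =
      ((seesawCharW F E c N₁ N₂ M eV e₁ e₂ J₁ J₂ JW hcδ hδ hd h₁ h₂ hW h₁d h₂d hWd hVd hJ₁ hJ₂ hJW hs hs₁ hs₂ u : ℂˣ) : ℂ) •
        finSumTensorLeft F N₁ N₂ M
          (((finPairRepW F E c N₁ M e₁ J₁ JW hcδ hδ hd h₁ hW h₁d hWd hJ₁ hJW hs₁).tprod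
            (finPairRepW F E c N₂ M e₂ J₂ JW hcδ hδ hd h₂ hW h₂d hWd hJ₂ hJW hs₂)) u x) := by
  induction x using TensorProduct.induction_on with
  | zero => simp only [map_zero, smul_zero]
  | tmul f₁ f₂ =>
    rw [Representation.tprod_apply, TensorProduct.map_tmul, finPairRepW_apply, finPairRepW_apply,
      ← finPairRep_finAdelicBlockDiag_one_finSumTensorLeft F E c N₁ N₂ M eV e₁ e₂ J₁ J₂ JW hcδ hδ hd h₁ h₂ hW h₁d h₂d hWd
        hVd hJ₁ hJ₂ hJW hs hs₁ hs₂ hχV 1 u f₁ f₂, Prod.mk_one_one, map_one]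
  | add x y hx hy => rw [map_add, map_add, hx, hy, map_add, map_add, smul_add]

include hχV in
/-- **V₁-side transport hypothesis** (this is where `hχV` enters): `ω_f^V(s)(k₁ ⊕ᶠ 1, 1) ∘ L = L ∘ (ω_f^{V₁}(s₁)(k₁,1) ⊗ 1)`
on ALL of `𝒮₁ ⊗ 𝒮₂`. [cite: Liu2021, proof of Thm. 4.15 (FJcycle.tex l. 2199–2210)] -/
theorem finPairRepV_finAdelicBlockDiag_finSumTensorLeft (k₁ : finAdelic F E c N₁ J₁)
    (x : FinSB F (Fin N₁ × Fin M) ⊗[ℂ] FinSB F (Fin N₂ × Fin M)) :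
    finPairRepV F E c (N₁ + N₂) M eV (finSum N₁ N₂ J₁ J₂) JW hcδ hδ hd (isSymm_finSum h₁ h₂) hW hVd hWd
        (finSum_eq_map_finSum F E N₁ N₂ J₁ J₂ hJ₁ hJ₂) hJW hs (finAdelicBlockDiag F E c N₁ N₂ J₁ J₂ (k₁, 1))
        (finSumTensorLeft F N₁ N₂ M x) =
      finSumTensorLeft F N₁ N₂ M
        (((finPairRepV F E c N₁ M e₁ J₁ JW hcδ hδ hd h₁ hW h₁d hWd hJ₁ hJW hs₁).tprod
          (1 : Representation ℂ (finAdelic F E c N₁ J₁) (FinSB F (Fin N₂ × Fin M)))) k₁ x) := by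
  induction x using TensorProduct.induction_on with
  | zero => simp only [map_zero]
  | tmul f₁ f₂ =>
    rw [Representation.tprod_apply, TensorProduct.map_tmul, MonoidHom.one_apply, Module.End.one_apply, finPairRepV_apply,
      finPairRep_finAdelicBlockDiag_one_finSumTensorLeft F E c N₁ N₂ M eV e₁ e₂ J₁ J₂ JW hcδ hδ hd h₁ h₂ hW h₁d h₂d hWd hVd
        hJ₁ hJ₂ hJW hs hs₁ hs₂ hχV k₁ 1 f₁ f₂, map_one, Units.val_one, one_smul, map_one, Module.End.one_apply,
      finPairRepV_apply]
  | add x y hx hy => rw [map_add, map_add, hx, hy, map_add, map_add]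

end FaceSplit

/-! ## §4 GENERIC: the split of `χ`-coinvariants along a tensor decomposition up to a character (pure `TwistedCoinv` algebra)

Stated over an arbitrary commutative ring so that the tensor product `S₁ ⊗[k] S₂` is formed ONCE from `[AddCommGroup Sᵢ]` (instantiating
at `FinSB` is then syntactic; forming `Coinv (ρ₁.tprod ρ₂) χ` directly over `FinSB … ⊗[ℂ] FinSB …` runs into an instance-path `whnf` cliff). -/

section Generic

variable {k : Type*} [CommRing k] {G H S S₁ S₂ : Type*} [Group G] [Group H]
  [AddCommGroup S] [Module k S] [AddCommGroup S₁] [Module k S₁] [AddCommGroup S₂] [Module k S₂]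
  (ρW : Representation k H S) (ρ₁ : Representation k H S₁) (ρ₂ : Representation k H S₂)
  (ρV : Representation k G S) (σ₁ : Representation k G S₁)
  (T : S₁ ⊗[k] S₂ ≃ₗ[k] S) (ξ χ : H →* kˣ)

/-- `(σ₁ ⊗ 1)(g)` commutes with the diagonal `(ρ₁ ⊗ ρ₂)(h)` when `σ₁(g)` commutes with `ρ₁(h)`.
[cite: GelbartRogawski1991, §3.1 Prop. 3.1.1 p. 455] -/
theorem commute_tprod_one_tprod (hc₁ : ∀ (g : G) (h : H), Commute (σ₁ g) (ρ₁ h)) (g : G) (h : H) :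
    Commute ((σ₁.tprod (1 : Representation k G S₂)) g) ((ρ₁.tprod ρ₂) h) := by
  change (σ₁.tprod (1 : Representation k G S₂)) g * (ρ₁.tprod ρ₂) h = (ρ₁.tprod ρ₂) h * (σ₁.tprod (1 : Representation k G S₂)) g
  rw [Representation.tprod_apply, Representation.tprod_apply, MonoidHom.one_apply, ← TensorProduct.map_mul,
    ← TensorProduct.map_mul, (hc₁ g h).eq, one_mul, mul_one]

/-- **the first-factor `G`-action on the split coinvariants**: `g ↦` the operator induced by `σ₁(g) ⊗ 1` on `Coinv (ρ₁ ⊗ ρ₂) (χ ξ⁻¹)`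
(the shape `ω⋆|_{U(J⋆)} ⊗ 1` of [Liu2021] l. 2199–2210; its restriction to the centre is G2c-core's `repFst`).
[cite: Liu2021, proof of Thm. 4.15 (FJcycle.tex l. 2199–2210); App. D §D.1 Step 3 (l. 5221)] -/
def splitRep (hc₁ : ∀ (g : G) (h : H), Commute (σ₁ g) (ρ₁ h)) :
    Representation k G (TwistedCoinv.Coinv (ρ₁.tprod ρ₂) (χ * ξ⁻¹)) :=
  TwistedCoinv.rep (χ * ξ⁻¹) (σ₁.tprod (1 : Representation k G S₂)) (commute_tprod_one_tprod ρ₁ ρ₂ σ₁ hc₁)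

/-- `splitRep g (mk (v ⊗ w)) = mk (σ₁ g v ⊗ w)`. [cite: Liu2021, App. D §D.1 Step 3 (l. 5221)] -/
theorem splitRep_mk_tmul (hc₁ : ∀ (g : G) (h : H), Commute (σ₁ g) (ρ₁ h)) (g : G) (v : S₁) (w : S₂) :
    splitRep ρ₁ ρ₂ σ₁ ξ χ hc₁ g (TwistedCoinv.mk _ _ (v ⊗ₜ w)) = TwistedCoinv.mk _ _ (σ₁ g v ⊗ₜ w) := by
  rw [splitRep, TwistedCoinv.rep_mk, Representation.tprod_apply, TensorProduct.map_tmul]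
  rfl

variable (hT : ∀ (u : H) (x : S₁ ⊗[k] S₂), ρW u (T x) = ((ξ u : kˣ) : k) • T ((ρ₁.tprod ρ₂) u x))

/-- **THE SPLIT OF THE `χ`-COINVARIANTS** along `T : S₁ ⊗ S₂ ≃ S` carrying `ρ₁ ⊗ ρ₂` to `ξ⁻¹ • ρW`:
`Coinv ρW χ ≃ₗ Coinv (ρ₁ ⊗ ρ₂) (χ · ξ⁻¹)` (★ `TwistedCoinv.mapEquiv` along `T⁻¹`). [cite: GelbartRogawski1991, §3.1 Remark p. 457]
[cite: Liu2021, App. D §D.1 Step 3 (l. 5221)] -/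
def splitCoinvEquiv : TwistedCoinv.Coinv ρW χ ≃ₗ[k] TwistedCoinv.Coinv (ρ₁.tprod ρ₂) (χ * ξ⁻¹) :=
  TwistedCoinv.mapEquiv ρW χ (ρ₁.tprod ρ₂) (χ * ξ⁻¹) T.symm (fun u => (ξ u)⁻¹)
    (fun u y => by
      obtain ⟨x, rfl⟩ := T.surjective y
      rw [T.symm_apply_apply, hT, map_smul, T.symm_apply_apply, smul_smul, Units.inv_mul, one_smul])
    (fun u => by rw [MonoidHom.mul_apply, MonoidHom.inv_apply, mul_comm])

/-- `splitCoinvEquiv (mk (T x)) = mk x`. [cite: Liu2021, App. D §D.1 Step 3 (l. 5221)] -/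
theorem splitCoinvEquiv_mk (x : S₁ ⊗[k] S₂) :
    splitCoinvEquiv ρW ρ₁ ρ₂ T ξ χ hT (TwistedCoinv.mk ρW χ (T x)) = TwistedCoinv.mk _ _ x := by
  rw [splitCoinvEquiv, TwistedCoinv.mapEquiv_mk, LinearEquiv.symm_apply_apply]

/-- **equivariance**: for a `G`-action `ρV` on `S` commuting with `ρW` and transported by `T` to `σ₁ ⊗ 1`, `splitCoinvEquiv` intertwines
`rep χ ρV` with `splitRep` (= `rep (χ ξ⁻¹) (σ₁ ⊗ 1)`). [cite: Liu2021, proof of Thm. 4.15 (FJcycle.tex l. 2199–2210)] -/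
theorem splitCoinvEquiv_rep (hc : ∀ (g : G) (h : H), Commute (ρV g) (ρW h)) (hc₁ : ∀ (g : G) (h : H), Commute (σ₁ g) (ρ₁ h))
    (hV : ∀ (g : G) (x : S₁ ⊗[k] S₂), ρV g (T x) = T ((σ₁.tprod (1 : Representation k G S₂)) g x))
    (g : G) (y : TwistedCoinv.Coinv ρW χ) :
    splitCoinvEquiv ρW ρ₁ ρ₂ T ξ χ hT (TwistedCoinv.rep χ ρV hc g y) =
      splitRep ρ₁ ρ₂ σ₁ ξ χ hc₁ g (splitCoinvEquiv ρW ρ₁ ρ₂ T ξ χ hT y) := by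
  have hg : ∀ v : S, (σ₁.tprod (1 : Representation k G S₂)) g (T.symm v) = (1 : k) • T.symm (ρV g v) := fun v => by
    rw [one_smul, ← T.symm_apply_apply ((σ₁.tprod (1 : Representation k G S₂)) g (T.symm v)), ← hV,
      T.apply_symm_apply]
  symm
  rw [splitCoinvEquiv, splitRep, TwistedCoinv.mapEquiv_rep ρW χ (ρ₁.tprod ρ₂) (χ * ξ⁻¹) ρV
    (σ₁.tprod (1 : Representation k G S₂)) hc (commute_tprod_one_tprod ρ₁ ρ₂ σ₁ hc₁) T.symm (fun u => (ξ u)⁻¹) _ _ (hg),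
    one_smul]

end Generic

/-! ## §5 The face identification = §4 at the finite Weil representations

(No type ascriptions are repeated here ON PURPOSE: the carriers `Coinv (ω_f^{V₁}|_{U(W)} ⊗ ω_f^{V₂}|_{U(W)}) (χ_W ξ⁻¹)` are the §4 ones
instantiated, so that `FinSB … ⊗[ℂ] FinSB …` inherits §4's instance path.) -/

section Face

variable (F E : Type) [Field F] [NumberField F] [Field E] [NumberField E] [Algebra F E]
variable (c : E ≃ₐ[F] E) (N₁ N₂ M : ℕ) {n n₁ n₂ : ℕ}
  (eV : Fin (N₁ + N₂) × Fin M ≃ Fin n) (e₁ : Fin N₁ × Fin M ≃ Fin n₁) (e₂ : Fin N₂ × Fin M ≃ Fin n₂)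
variable (J₁ : Matrix (Fin N₁) (Fin N₁) E) (J₂ : Matrix (Fin N₂) (Fin N₂) E) (JW : Matrix (Fin M) (Fin M) E)
variable {T₁ : Matrix (Fin N₁) (Fin N₁) F} {T₂ : Matrix (Fin N₂) (Fin N₂) F} {TW : Matrix (Fin M) (Fin M) F}
variable [Algebra.IsQuadraticExtension F E] {δ : E} (hcδ : c δ = -δ) (hδ : δ ≠ 0) {d : F}
  (hd : δ * δ = algebraMap F E d) (h₁ : T₁.IsSymm) (h₂ : T₂.IsSymm) (hW : TW.IsSymm) (h₁d : IsUnit T₁.det)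
  (h₂d : IsUnit T₂.det) (hWd : IsUnit TW.det) (hVd : IsUnit (finSum N₁ N₂ T₁ T₂).det)
  (hJ₁ : J₁ = T₁.map (algebraMap F E)) (hJ₂ : J₂ = T₂.map (algebraMap F E)) (hJW : JW = TW.map (algebraMap F E))
variable {s : adelicPair F E c (N₁ + N₂) M (finSum N₁ N₂ J₁ J₂) JW →*
    adelicMpCont F (Fin n) (adelicGram F eV (finSum N₁ N₂ T₁ T₂) TW)}
  {s₁ : adelicPair F E c N₁ M J₁ JW →* adelicMpCont F (Fin n₁) (adelicGram F e₁ T₁ TW)}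
  {s₂ : adelicPair F E c N₂ M J₂ JW →* adelicMpCont F (Fin n₂) (adelicGram F e₂ T₂ TW)}
  (hs : (splittingDatum F E c (N₁ + N₂) M eV (finSum N₁ N₂ J₁ J₂) JW hcδ hδ hd (isSymm_finSum h₁ h₂) hW hVd hWd
    (finSum_eq_map_finSum F E N₁ N₂ J₁ J₂ hJ₁ hJ₂) hJW).IsCompatible s)
  (hs₁ : (splittingDatum F E c N₁ M e₁ J₁ JW hcδ hδ hd h₁ hW h₁d hWd hJ₁ hJW).IsCompatible s₁)
  (hs₂ : (splittingDatum F E c N₂ M e₂ J₂ JW hcδ hδ hd h₂ hW h₂d hWd hJ₂ hJW).IsCompatible s₂)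
  (hχV : ∀ g₁ : adelic F E c N₁ J₁,
    mpSeesawCharLeft F E c N₁ N₂ M eV e₁ e₂ J₁ J₂ JW hcδ hδ hd h₁ h₂ hW h₁d h₂d hWd hVd hJ₁ hJ₂ hJW hs hs₁ hs₂ ((g₁, 1), 1) = 1)
  (χW : finAdelic F E c M JW →* ℂˣ)

/-- **THE FACE IDENTIFICATION**
`Φ : Coinv (ω_f^V(s)|_{U(W)}) χ_W ≃ₗ[ℂ] Coinv (ω_f^{V₁}(s₁)|_{U(W)} ⊗ ω_f^{V₂}(s₂)|_{U(W)}) (χ_W · ξ⁻¹)`: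
the `χ_W`-coinvariants of the finite Weil representation of `U(J₁ ⊕ᶠ J₂) × U(J_W)` ARE the `(χ_W · ξ⁻¹)`-coinvariants of the tensor
product of the two small ones under the diagonal `U(J_W)` (`splitCoinvEquiv` at `T := finSumTensorLeft`, `ξ := seesawCharW`,
`hT := finPairRepW_finSumTensorLeft`).  For `M = 1`, `J_W = ⟨a⟩` and the χ-splittings of [Liu2021, App. D Step 2] the source is
`omegaAtLine … (J⋆ ⊕ᶠ J⊥) … a χ_W` by `rfl`. [cite: Liu2021, proof of Thm. 4.15 (FJcycle.tex l. 2199–2210); App. D §D.1 Step 3 (l. 5221)]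
[cite: Kudla1984, §1] -/
def faceSplitCoinvEquiv :=
  splitCoinvEquiv
    (finPairRepW F E c (N₁ + N₂) M eV (finSum N₁ N₂ J₁ J₂) JW hcδ hδ hd (isSymm_finSum h₁ h₂) hW hVd hWd
      (finSum_eq_map_finSum F E N₁ N₂ J₁ J₂ hJ₁ hJ₂) hJW hs)
    (finPairRepW F E c N₁ M e₁ J₁ JW hcδ hδ hd h₁ hW h₁d hWd hJ₁ hJW hs₁)
    (finPairRepW F E c N₂ M e₂ J₂ JW hcδ hδ hd h₂ hW h₂d hWd hJ₂ hJW hs₂)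
    (finSumTensorLeft F N₁ N₂ M)
    (seesawCharW F E c N₁ N₂ M eV e₁ e₂ J₁ J₂ JW hcδ hδ hd h₁ h₂ hW h₁d h₂d hWd hVd hJ₁ hJ₂ hJW hs hs₁ hs₂) χW
    (finPairRepW_finSumTensorLeft F E c N₁ N₂ M eV e₁ e₂ J₁ J₂ JW hcδ hδ hd h₁ h₂ hW h₁d h₂d hWd hVd hJ₁ hJ₂ hJW hs hs₁ hs₂ hχV)

/-- **the `U(J₁)(𝔸_f)`-action on the target**: `k₁ ↦` the operator of `ω_f^{V₁}(s₁)(k₁,1) ⊗ 1` on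
`Coinv (ω_f^{V₁}|_{U(W)} ⊗ ω_f^{V₂}|_{U(W)}) (χ_W ξ⁻¹)` (`splitRep` at `σ₁ := finPairRepV … hs₁`).
[cite: Liu2021, proof of Thm. 4.15 (FJcycle.tex l. 2199–2210)] -/
def faceSplitRep :=
  splitRep
    (finPairRepW F E c N₁ M e₁ J₁ JW hcδ hδ hd h₁ hW h₁d hWd hJ₁ hJW hs₁)
    (finPairRepW F E c N₂ M e₂ J₂ JW hcδ hδ hd h₂ hW h₂d hWd hJ₂ hJW hs₂)
    (finPairRepV F E c N₁ M e₁ J₁ JW hcδ hδ hd h₁ hW h₁d hWd hJ₁ hJW hs₁)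
    (seesawCharW F E c N₁ N₂ M eV e₁ e₂ J₁ J₂ JW hcδ hδ hd h₁ h₂ hW h₁d h₂d hWd hVd hJ₁ hJ₂ hJW hs hs₁ hs₂) χW
    (commute_finPairRepV_finPairRepW F E c N₁ M e₁ J₁ JW hcδ hδ hd h₁ hW h₁d hWd hJ₁ hJW hs₁)

/-- `faceSplitCoinvEquiv (mk (L x)) = mk x` (`L = finSumTensorLeft`; on products `mk (f₁ ⊠ f₂) ↦ mk (f₁ ⊗ f₂)`).
[cite: Liu2021, App. D §D.1 Step 3 (l. 5221)] -/
theorem faceSplitCoinvEquiv_mk (x : FinSB F (Fin N₁ × Fin M) ⊗[ℂ] FinSB F (Fin N₂ × Fin M)) :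
    faceSplitCoinvEquiv F E c N₁ N₂ M eV e₁ e₂ J₁ J₂ JW hcδ hδ hd h₁ h₂ hW h₁d h₂d hWd hVd hJ₁ hJ₂ hJW hs hs₁ hs₂ hχV χW
        (TwistedCoinv.mk _ χW (finSumTensorLeft F N₁ N₂ M x)) = TwistedCoinv.mk _ _ x :=
  splitCoinvEquiv_mk _ _ _ _ _ _ _ x

/-- **`U(J₁)(𝔸_f)`-EQUIVARIANCE of the face identification**: `faceSplitCoinvEquiv` carries the face action
`weilCoinv^V(k₁ ⊕ᶠ 1)` (the restriction along `u ↦ u ⊕ 1`, [Liu2021] l. 2199 `R_B(u ⊕ 1)`) to `faceSplitRep k₁` (`ω_f^{V₁}(s₁)(k₁) ⊗ 1`,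
whose first factor on `Coinv` is `weilCoinv^{V₁}`, i.e. `rhoVAtLine` for `M = 1`). [cite: Liu2021, proof of Thm. 4.15 (FJcycle.tex l. 2199–2210)] -/
theorem faceSplitCoinvEquiv_weilCoinv (k₁ : finAdelic F E c N₁ J₁)
    (y : TwistedCoinv.Coinv
      (finPairRepW F E c (N₁ + N₂) M eV (finSum N₁ N₂ J₁ J₂) JW hcδ hδ hd (isSymm_finSum h₁ h₂) hW hVd hWd
        (finSum_eq_map_finSum F E N₁ N₂ J₁ J₂ hJ₁ hJ₂) hJW hs) χW) :
    faceSplitCoinvEquiv F E c N₁ N₂ M eV e₁ e₂ J₁ J₂ JW hcδ hδ hd h₁ h₂ hW h₁d h₂d hWd hVd hJ₁ hJ₂ hJW hs hs₁ hs₂ hχV χW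
        (weilCoinv F E c (N₁ + N₂) M eV (finSum N₁ N₂ J₁ J₂) JW hcδ hδ hd (isSymm_finSum h₁ h₂) hW hVd hWd
          (finSum_eq_map_finSum F E N₁ N₂ J₁ J₂ hJ₁ hJ₂) hJW χW hs (finAdelicBlockDiag F E c N₁ N₂ J₁ J₂ (k₁, 1)) y) =
      faceSplitRep F E c N₁ N₂ M eV e₁ e₂ J₁ J₂ JW hcδ hδ hd h₁ h₂ hW h₁d h₂d hWd hVd hJ₁ hJ₂ hJW hs hs₁ hs₂ χW k₁
        (faceSplitCoinvEquiv F E c N₁ N₂ M eV e₁ e₂ J₁ J₂ JW hcδ hδ hd h₁ h₂ hW h₁d h₂d hWd hVd hJ₁ hJ₂ hJW hs hs₁ hs₂ hχV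
          χW y) := by
  exact splitCoinvEquiv_rep
    (finPairRepW F E c (N₁ + N₂) M eV (finSum N₁ N₂ J₁ J₂) JW hcδ hδ hd (isSymm_finSum h₁ h₂) hW hVd hWd
      (finSum_eq_map_finSum F E N₁ N₂ J₁ J₂ hJ₁ hJ₂) hJW hs)
    (finPairRepW F E c N₁ M e₁ J₁ JW hcδ hδ hd h₁ hW h₁d hWd hJ₁ hJW hs₁)
    (finPairRepW F E c N₂ M e₂ J₂ JW hcδ hδ hd h₂ hW h₂d hWd hJ₂ hJW hs₂)
    ((finPairRepV F E c (N₁ + N₂) M eV (finSum N₁ N₂ J₁ J₂) JW hcδ hδ hd (isSymm_finSum h₁ h₂) hW hVd hWd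
      (finSum_eq_map_finSum F E N₁ N₂ J₁ J₂ hJ₁ hJ₂) hJW hs).comp
      ((finAdelicBlockDiag F E c N₁ N₂ J₁ J₂).comp (MonoidHom.inl (finAdelic F E c N₁ J₁) (finAdelic F E c N₂ J₂))))
    (finPairRepV F E c N₁ M e₁ J₁ JW hcδ hδ hd h₁ hW h₁d hWd hJ₁ hJW hs₁)
    (finSumTensorLeft F N₁ N₂ M)
    (seesawCharW F E c N₁ N₂ M eV e₁ e₂ J₁ J₂ JW hcδ hδ hd h₁ h₂ hW h₁d h₂d hWd hVd hJ₁ hJ₂ hJW hs hs₁ hs₂) χW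
    (finPairRepW_finSumTensorLeft F E c N₁ N₂ M eV e₁ e₂ J₁ J₂ JW hcδ hδ hd h₁ h₂ hW h₁d h₂d hWd hVd hJ₁ hJ₂ hJW hs hs₁ hs₂ hχV)
    (fun g h => commute_finPairRepV_finPairRepW F E c (N₁ + N₂) M eV (finSum N₁ N₂ J₁ J₂) JW hcδ hδ hd (isSymm_finSum h₁ h₂) hW
      hVd hWd (finSum_eq_map_finSum F E N₁ N₂ J₁ J₂ hJ₁ hJ₂) hJW hs _ h)
    (commute_finPairRepV_finPairRepW F E c N₁ M e₁ J₁ JW hcδ hδ hd h₁ hW h₁d hWd hJ₁ hJW hs₁)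
    (fun g x => finPairRepV_finAdelicBlockDiag_finSumTensorLeft F E c N₁ N₂ M eV e₁ e₂ J₁ J₂ JW hcδ hδ hd h₁ h₂ hW h₁d h₂d
      hWd hVd hJ₁ hJ₂ hJW hs hs₁ hs₂ hχV g x) k₁ y

end Face

end Literature.NumberTheory.GelbartRogawski1991.UnitaryDualPair

end
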